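import Mathlib
import HarnessLib
import HarnessLib.Audit
import Summits.AtomisticToContinuum.Statement

/-!
Route: FirstFailureBlowup

CLOSED (retired) 2026-08-15T13:42:30Z by operator:999:1257524 — reason: not-a-thesis: assembly does not conclude the sub-problem Statement — note: D-0027 §2.1 audit (human 2026-08-15: routes that do not decide the summit are removed): the assembly concludes `Literature.MathematicalPhysics.KineticTheory.HydrodynamicLimit`, not the sub-problem statement; a NEW conforming route may be opened from the same idea (generated `closes : … → _root_.Hydr. The file is kept as the record of this route; refuted decls are indexed as negative knowledge (`ledger negatives`).

Route FirstFailureBlowup — realises idea card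
AtomisticToContinuum/HydrodynamicLimit/first-failure-blowup ("blow-up at the first failure time:
hyperbolic scaling covariance reduces the large-data Euler limit to near-equilibrium hydrodynamics
with a Knudsen gain").

X (it suffices to show) = RESTARTABLE SHORT-TIME PROPAGATION IN THE ENTROPY CURRENCY, three
statements over the conjunct's own vocabulary:
(C1, ShortTimePropagation, crux rank 2) along any classical hard-sphere-Euler solution on [0,T) and
for every T' < T there is τ > 0 such that at every restart time s ≤ T': if the true law (Φ_s)_*
localGibbsLaw σ a₀ u₀ θ₀ is o(N)-close in specific relative entropy (Mathlib klDiv) to SOME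
exponentially concentrating local Gibbs law localGibbsLaw σ a (u s) (θ s) around the Euler profile
U(s), then the empirical density/momentum/energy fields converge in probability
(TendstoHydroFieldsAt) to U(t) for all t ∈ [s, min(T', s+τ)];
(C2, RestartEntropy, crux rank 3) conversely, convergence in probability of the fields at a time t <
T (from the exact local Gibbs datum) gives klDiv((Φ_t)_* P ‖ ψ_t)/(N+1) → 0 for every exponentially
concentrating local Gibbs reference ψ_t with profile U(t): Liouville invariance pins ∫ f log f, so
H(f_t|ψ_t)/(N+1) → S(U_t) − S(U_0), which vanishes for classical (isentropic) solutions;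
(C3, ProfileRealisability, crux rank 4) whenever the fields converge at t, the profile U(t) is
realised by a continuous positive activity a_t whose canonical local Gibbs laws concentrate
exponentially around U(t).
C1 → C2 → C3 → LocalGibbsConcentration (stmt-0767, shared) → HydrodynamicLimit is a finite restart
induction over steps of length τ (Assembly, soft).

THE MECHANISM behind C1 is the card's minimal-counterexample/blow-up argument read through an EXACT
symmetry of the conjunct: lengths and times ×1/r map the N-sphere unit torus observed on balls of
radius r for macroscopic time rτ₀ to a system of N r³ spheres per unit volume at the SAME reduced
density σ (diameter σN^{-1/3}/r = σ(Nr³)^{-1/3}) observed for unit time, with data of amplitude O(r)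
and j-th derivatives O(r^j). At the first failure time the state is still o(N)-close to local Gibbs
(C2), so C1 with τ = r(‖U‖_{C^k[0,T']})·τ₀ is SMALL-DATA hydrodynamics with automatic Knudsen gain
(typed below as support SmallDataHydrodynamics: uniform σ₀, δ₀, τ₀ over C²-near-constant data on the
unit torus) plus macroscopic locality (second layer, definition request filed). Large data are never
attacked directly; no Gronwall, no ergodic classification.

Lean (all decls elaborate; namespace
Summit.AtomisticToContinuum.HydrodynamicLimit.Theses.FirstFailureBlowup):
Assembly := ShortTimePropagation → RestartEntropy → ProfileRealisability → LocalGibbsConcentration →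
Literature.MathematicalPhysics.KineticTheory.HydrodynamicLimit.

Rationale: WHY THIS LINE. The seven open routes attack large data globally in time (ergodic classification
0779, cumulant expansion, compactness + weak-strong, vanishing noise, Glauber calculus on the data,
implosion bookkeeping). The card isolates two FREE structures of the conjunct: (i) exact hyperbolic
scaling covariance at fixed reduced density (Spohn1991 Part I Ch.3: a ball of radius r at scale r is
an N r³-sphere system at the same σ), (ii) Liouville-pinned entropy: ∫ f_t log f_t is conserved and
−log ψ_t is a one-body functional, so Yau's H(f_t|ψ_t)/N (Yau1991; OllaVaradhanYau1993 §3;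
KipnisLandim1999 Ch.6) equals S(U_t) − S(U_0) + o(1) as soon as the mean fields follow U_t (cards
invariant-gibbs-entropy-bookkeeping, restart-principle R1). With (ii) the first failure time t* of
the conjunct is a time at which the law is still o(N)-close to local Gibbs; with (i) zooming into
the ball where the defect is born gives near-constant data with Knudsen number → 0 — the
statistical-mechanics twin of the Kenig–Merle critical-element template
(doi:10.1007/s00222-006-0011-4, doi:10.1007/s11511-008-0031-6: minimal blow-up object + symmetry
group + small-data theory). Run as its contrapositive the blow-up argument is a restart induction
(Assembly) whose only dynamical input is C1; the covariant reading of C1 is small-data hydrodynamics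
(support SmallDataHydrodynamics) + locality. Imported areas: critical dispersive/hyperbolic PDE
(architecture), equilibrium statistical mechanics at low density (C2, C3 statics: Ruelle1969 §3.4,
LebowitzPenrose1964). Correction to the card made here: its "entropy pigeonhole over balls" is false
as stated (global relative entropy may sit in inter-block correlations); the additive defect is the
MEAN conserved field, which (ii) makes equivalent to the entropy defect — hence restart currency =
entropy, defect = fields in probability.
RANKED CRUXES. (2) ShortTimePropagation — the dynamical content; τ uniform in s ≤ T'; open even
linearised (Spohn1991 §7.1 (7.13)-(7.19)); nearest theorems: near-equilibrium hard spheres in the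
DILUTE scaling (BGSSCPAM2023). (3) RestartEntropy — fields in probability at t ⇒ o(N) entropy at t;
inputs PressureFunctional, activity–density duality, isentropy of classical hs-Euler with the EOS of
HsEosLowDensity (0768), uniform integrability (KineticEnergyExpMoment); converse of Assembly 0769,
makes RelEntropyVanishing (0766) EQUIVALENT to the conjunct pre-shock. (4) ProfileRealisability —
inverse equation of state along the solution with exponential concentration; static at low density,
dynamic content = the solution staying dilute although σ₀ is fixed from the initial profiles:
implied by DiluteSelfConsistency (stmt-3091, route ImplosionLoophole) + statics, refuted with it by
DenseExcursion (3090).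
SUPPORT (typed, rank 9): SmallDataHydrodynamics (unit torus; rest state (1, ū, θ̄); C²-δ₀-small
Euler data; conclusion for t < min(T, τ₀); uniform σ₀ — intended child of C1 and a milestone
strictly easier than the conjunct in substance); LocalGibbsConcentration (= stmt-0767: base case +
probability of the laws, which the conjunct does not assume); PressureFunctional (canonical
inhomogeneous thermodynamic limit of (N+1)⁻¹ log canonicalPartition); KineticEnergyExpMoment
(Gaussian tails + exact energy conservation, uniform in t).
ASSEMBLY (soft). σ₀ := min of four. Base s = 0: flow 0 = id a.e. so lawAt P 0 = P and klDiv P P = 0;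
uniqueness of limits in probability + 0767 give (ρ 0, u 0, θ 0) = (ρ^{a₀}, u₀, θ₀), so the datum is
its own concentrating reference. Step: s_k := min T' (kτ); C1 gives the fields on [s_k, s_{k+1}], C3
then C2 give the entropy hypothesis at s_{k+1}; ⌈T'/τ⌉ steps; finally T' := t for each t < T.
KILL CRITERIA. ¬SmallDataHydrodynamics (an O(1)-slow non-hydrodynamic mode near equilibrium at fixed
σ; MD falsifier: damping of a small shear/entropy wave per sound period must scale like Kn) kills C1
and the line, and wounds every route. ¬ProfileRealisability through DenseExcursion (3090) kills C3
together with 0766 and plausibly the conjunct (operator alarm). ¬RestartEntropy with convergent mean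
fields pre-shock can only come from EOS junk values (limsup/deriv outside the analytic window) —
statement-level pathology, report.
NOT DECOMPOSED YET. Second layer of C1 (after C1 moves or the definition lands): children
SmallDataHydrodynamics + MacroscopicLocality (light cone in law for entropy-close data;
Alexander1975 dynamical clusters; thermal speeds O(√log N) — where HighMomentumCutoff bites) +
covariance/transplant glue (cut B(x₀,2r), re-embed as an N(4r)³-sphere unit-torus system: exact at
fixed σ; needs HsEulerLocalExistence of DissipativeWeakStrong for the extended data). Definition
request: law of the ball-restricted empirical measure. C2's statics (duality, isentropy identity,
LLN uniqueness) ride as --supports lemmas. No inspiration notes were read (plancard mode).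
NOVELTY / BARRIERS: dedicated fields below.

Novelty: Nearest prior art actually searched (lit search --hybrid ×3: near-equilibrium/small-data
hydrodynamic limits for hard spheres; minimal-counterexample/blow-up reductions for particle
systems; short-time/restart entropy method — only textbook hits KipnisLandim1999, Spohn1991,
DeMasiPresutti1991, SaintRaymond2009; no statistical-mechanics instance of a blow-up/rigidity
reduction found; plus the card's triage refs): Kenig–Merle doi:10.1007/s00222-006-0011-4 and
doi:10.1007/s11511-008-0031-6 (critical element = minimal blow-up solution + symmetry group +
small-data theory, PDE side only); Yau1991, OllaVaradhanYau1993, KipnisLandim1999 Ch.6 (the relative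
entropy functional, used there with a global Gronwall and noise-driven ergodicity); Spohn1991 Part I
Ch.3 and §7.1 (scale invariance of the Euler scaling; near-equilibrium fluctuation theory as the
perturbative corner, linearised hydrodynamics open); BGSSCPAM2023 (long-time near-equilibrium
hard-sphere dynamics, but in the Boltzmann–Grad scaling). DELTA: exact hyperbolic covariance at
fixed σ + Liouville-pinned entropy reduce the large-data deterministic Euler limit to a restartable
short-time statement (ShortTimePropagation) whose covariant reading is small-data hydrodynamics with
automatic Knudsen gain (SmallDataHydrodynamics), glued by a soft restart induction with an exact
entropy identity (RestartEntropy) instead of a Gronwall inequality; none of the three statements is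
typed or attacked elsewhere on the board. Sibling cards:  [refs: 10.1007/s00222-006-0011-4, 10.1007/s11511-008-0031-6, doi:10.1007/s00222-006-0011-4, doi:10.1007/s11511-008-0031-6, KipnisLandim1999, Spohn1991, SaintRaymond2009, Yau1991, OllaVaradhanYau1993, BGSSCPAM2023]

Barriers (technique_class: relative-entropy restart scaling-covariance small-data): technique_class: relative-entropy restart scaling-covariance small-data
- Literature.Barriers.AtomisticToContinuum.BoltzmannHypothesisBarrier: relative entropy is the
currency, but the step "stationary + translation invariant + finite entropy ⇒ Gibbs" is never
invoked; the only dynamical input is ShortTimePropagation, whose covariant form is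
near-GLOBAL-equilibrium propagation on finite systems, to be attacked by
near-equilibrium/linear-response and locality tools. The barrier's ideal-gas kernel is respected:
for free flight SmallDataHydrodynamics is false (shear waves phase-mix at rate O(1), no Knudsen
gain), so the line proves nothing there, as it must.
- Literature.Barriers.AtomisticToContinuum.BoltzmannHypothesisBarrierNarrow: no one-block
replacement of currents by Gibbs expectations via a classification of invariant states (cruxes
0779/0780 are not used); RestartEntropy is an identity between times 0 and t, not a bound on dH/dt.
- Literature.Barriers.AtomisticToContinuum.HighMomentumCutoffBarrier: PARTLY MET, stated not evaded
— RestartEntropy needs uniform integrability of the |v|² fields (support KineticEnergyExpMoment: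
Gaussian tails + exact energy conservation, no modification of the kinetic energy) and the future
locality child must propagate velocity tails (thermal speeds O(√log N)).
- Literature.Barriers.AtomisticToContinuum.HighMomentumCutoffBarrierNarrow: the cubic energy-current
moments of Yau's Gronwall never appear (no time derivative of H is taken).
- Liter

History (route lifecycle, newest last):
- 2026-08-15T13:42:30Z · CLOSED retired — not-a-thesis: assembly does not conclude the sub-problem Statement (operator:999:1257524)

sub-problem: HydrodynamicLimit · status: closed(retired) · opened planner-plancard-AtomisticToContinuum-Hydrody-e46ddbb7-0 2026-08-15T11:16:42Z · rev 0 · ledger route-AtomisticToContinuum-FirstFailureBlowup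
GENERATED by the gate from the ledger (D-0016/17). Provers cite these decls: `theorem foo : Summit.AtomisticToContinuum.HydrodynamicLimit.Theses.FirstFailureBlowup.<Decl> := …` in Summits/AtomisticToContinuum/HydrodynamicLimit/Theorems/<Name>.lean.
-/

namespace Summit.AtomisticToContinuum.HydrodynamicLimit.Theses.FirstFailureBlowup

open scoped BigOperators Topology Manifold Classical MeasureTheory ProbabilityTheory Matrix InnerProductSpace ComplexConjugate ContinuousMap
open Filter Set Function TopologicalSpace MeasureTheory

attribute [summit_statement] _root_.HydrodynamicLimit

/-- item stmt-AtomisticToContinuum-3329 · crux · rank 2 · closed · moot by None · by planner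
why it might fail: It is the near-equilibrium hydrodynamic limit in disguise: needs hydrodynamic relaxation of shear/sound/heat modes of deterministic spheres at fixed σ, open even linearised (Spohn1991 §7.1 (7.13)-(7.19)); an O(1)-slow non-hydrodynamic mode or locality lost via velocity tails breaks τ>0 uniform in s.
sources: Spohn1991, Yau1991, KipnisLandim1999, OllaVaradhanYau1993, BGSSCPAM2023
[crux] RESTARTABLE SHORT-TIME PROPAGATION (card first-failure-blowup, cruxes 1+2 in covariant form).
Along a classical hs-Euler solution, for every T' < T there is τ > 0 such that at any restart time s
≤ T': if the true law (Φ_s)_* localGibbsLaw σ a₀ u₀ θ₀ is o(N)-close in specific relative entropy to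
some exponentially concentrating local Gibbs law with profile (a, u_s, θ_s) around U(s), then the
empirical fields converge in probability to U(t) for t ∈ [s, min(T', s+τ)]. COVARIANT READING (the
mechanism): lengths/times ×1/r map the N-sphere torus at scale r to N r³ spheres per unit volume at
the SAME σ (diameter σ(Nr³)^{-1/3}); with τ = r·τ₀ and r = r(‖U‖_{C^k[0,T']}) this is unit-time
propagation for O(r)-amplitude, zoomed-C^k-small data with Knudsen number → 0 automatically — the
small-data theorem with Knudsen gain, localised. Equivalent (condition the reference on the bad
event / entropy inequality) to an LD-type upper bound e^{-cN} for the fields under EXACT local Gibbs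
data over [s, s+τ]. Intended split (second layer): SmallDataHydrodynamics + MacroscopicLocality +
covariance/transplant glue. Sources: Spohn1991 I.3 and §7.1; Yau1991; KipnisLandim1999 Ch.6;
BGSSCPAM2023. -/
@[route_item "route-AtomisticToContinuum-FirstFailureBlowup"]
def ShortTimePropagation : Prop :=
  open Literature.MathematicalPhysics.KineticTheory Literature.Analysis.FluidPDE in ∀ (a₀ θ₀ : T3 → ℝ) (u₀ : T3 → V3), Continuous a₀ → Continuous θ₀ → Continuous u₀ → (∀ x, 0 < a₀ x) → (∀ x, 0 < θ₀ x) → ∃ σ₀ : ℝ, 0 < σ₀ ∧ ∀ σ : ℝ, 0 < σ → σ < σ₀ → ∀ (T : ℝ) (ρ θ : ℝ → T3 → ℝ) (u : ℝ → T3 → V3), IsHardSphereEulerSolution σ T ρ u θ → ∀ Φ : (N : ℕ) → HardSphereFlow (Torus.geometry (Fin 3)) (hsDiameter σ N) (N + 1), let P := fun N => localGibbsLaw σ a₀ u₀ θ₀ N (Φ N); (∀ N, IsProbabilityMeasure (P N)) → TendstoHydroFieldsAt P Φ ρ u θ 0 → ∀ T' : ℝ, 0 ≤ T' → T' < T → ∃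 τ : ℝ, 0 < τ ∧ ∀ s ∈ Icc 0 T', ∀ a : T3 → ℝ, Continuous a → (∀ x, 0 < a x) → let ψ := fun N => localGibbsLaw σ a (u s) (θ s) N (Φ N); (∀ N, IsProbabilityMeasure (ψ N)) → (∀ χ : T3 → ℝ, Continuous χ → ∀ δ : ℝ, 0 < δ → ∃ C : ℝ, 0 < C ∧ ∀ N : ℕ, ψ N {z | δ < |empiricalDensityField z χ - ∫ x, χ x * ρ s x|} ≤ ENNReal.ofReal (C * Real.exp (-(C⁻¹ * (N + 1)))) ∧ ψ N {z | δ < ‖empiricalMomentumField z χ - ∫ x, (χ x * ρ s x) • u s x‖} ≤ ENNReal.ofReal (C * Real.exp (-(C⁻¹ * (N + 1)))) ∧ ψ N {z | δ < |empiricalEnergyField z χ - ∫ x, χ x * totalEnergyDensity (ρ s x) (u s x) (θ s x)|} ≤ ENNReal.ofReal (C * Real.exp (-(C⁻¹ * (N + 1))))) → Tendsto (fun N : ℕ => InformationTheory.klDiv ((Φ N).lawAt (P N) s) (ψ N) / ((N : ENNReal) + 1)) atTop (𝓝 0) → ∀ t ∈ Icc s (min T' (s + τ)), TendstoHydroFieldsAt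 P Φ ρ u θ t

/-- item stmt-AtomisticToContinuum-3330 · crux · rank 3 · closed · moot by None · by planner
why it might fail: Needs exact activity–density duality and the isentropy identity S(U_t)=S(U_0) with the SAME free energy as hsPressure (limsup/deriv junk beyond the analytic low-density window): if compression drives ρ_tσ³ past that window H/N need not vanish; also UI of |v|² fields under the evolved law.
sources: Yau1991, OllaVaradhanYau1993, KipnisLandim1999, Ruelle1969, LebowitzPenrose1964
[crux] RESTART IN THE ENTROPY CURRENCY (Liouville-pinned entropy; cards
invariant-gibbs-entropy-bookkeeping, restart-principle R1). For t < T and any continuous positive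
activity a whose local Gibbs laws ψ_t = localGibbsLaw σ a (u t) (θ t) are probability measures
concentrating exponentially around U(t): convergence in probability of the fields at time t (from
the exact local Gibbs datum) implies klDiv((Φ_t)_* P ‖ ψ_t)/(N+1) → 0. Proof shape: ∫ f_t log f_t is
conserved (Liouville), −log ψ_t = log Z_t + Σ_i Λ_t(x_i,v_i) with Λ_t a combination of (1, v,
|v|²/2) with continuous coefficients (the velocity integrals of localGibbsProfile are 1, so Z_t
depends on a only), hence H(f_t|ψ_t)/(N+1) = (N+1)⁻¹[log Z_t − log Z_0] + E[fields against Λ_t] −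
E[fields against Λ_0] → S(U_t) − S(U_0) = 0 for classical (isentropic) solutions. Inputs:
PressureFunctional, activity–density duality at low density (Ruelle1969 §3.4, LebowitzPenrose1964,
HsEosLowDensity 0768), uniform integrability (KineticEnergyExpMoment). Converse of Assembly 0769;
makes RelEntropyVanishing (0766) equivalent to the conjunct pre-shock. -/
@[route_item "route-AtomisticToContinuum-FirstFailureBlowup"]
def RestartEntropy : Prop :=
  open Literature.MathematicalPhysics.KineticTheory Literature.Analysis.FluidPDE in ∀ (a₀ θ₀ : T3 → ℝ) (u₀ : T3 → V3), Continuous a₀ → Continuous θ₀ → Continuous u₀ → (∀ x, 0 < a₀ x) → (∀ x, 0 < θ₀ x) → ∃ σ₀ : ℝ, 0 < σ₀ ∧ ∀ σ : ℝ, 0 < σ → σ < σ₀ → ∀ (T : ℝ) (ρ θ : ℝ → T3 → ℝ) (u : ℝ → T3 → V3), IsHardSphereEulerSolution σ T ρ u θ → ∀ Φ : (N : ℕ) → HardSphereFlow (Torus.geometry (Fin 3)) (hsDiameter σ N) (N + 1), let P := fun N => localGibbsLaw σ a₀ u₀ θ₀ N (Φ N); (∀ N, IsProbabilityMeasure (P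 N)) → TendstoHydroFieldsAt P Φ ρ u θ 0 → ∀ t ∈ Ico 0 T, ∀ a : T3 → ℝ, Continuous a → (∀ x, 0 < a x) → let ψ := fun N => localGibbsLaw σ a (u t) (θ t) N (Φ N); (∀ N, IsProbabilityMeasure (ψ N)) → (∀ χ : T3 → ℝ, Continuous χ → ∀ δ : ℝ, 0 < δ → ∃ C : ℝ, 0 < C ∧ ∀ N : ℕ, ψ N {z | δ < |empiricalDensityField z χ - ∫ x, χ x * ρ t x|} ≤ ENNReal.ofReal (C * Real.exp (-(C⁻¹ * (N + 1)))) ∧ ψ N {z | δ < ‖empiricalMomentumField z χ - ∫ x, (χ x * ρ t x) • u t x‖} ≤ ENNReal.ofReal (C * Real.exp (-(C⁻¹ * (N + 1)))) ∧ ψ N {z | δ < |empiricalEnergyField z χ - ∫ x, χ x * totalEnergyDensity (ρ t x) (u t x) (θ t x)|} ≤ ENNReal.ofReal (C * Real.exp (-(C⁻¹ * (N + 1))))) → TendstoHydroFieldsAt P Φ ρ u θ t → Tendsto (fun N : ℕ => InformationTheory.klDiv ((Φ N).lawAt (P N) t) (ψ N) / ((N : ENNReal) + 1)) atTop (𝓝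 0)

/-- item stmt-AtomisticToContinuum-3331 · crux · rank 4 · closed · moot by None · by planner
why it might fail: σ₀ is chosen before the solution: pre-shock compression/implosion (MerleEtAl2022, polytropic gas; DenseExcursion stmt-3090) may push ρ_tσ³ beyond the low-density uniqueness/analyticity window, where no continuous activity with exponentially concentrating canonical law need exist.
sources: Ruelle1969, LebowitzPenrose1964, MerleEtAl2022, Spohn1991
[crux] REALISABILITY OF THE EULER PROFILE BY CONCENTRATING LOCAL GIBBS LAWS. For t < T, if the
empirical fields converge in probability to U(t) = (ρ_t, ρ_t u_t, E_t), then there is a continuous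
positive activity a_t such that localGibbsLaw σ a_t (u t) (θ t) are probability measures whose three
fields concentrate exponentially (≤ C e^{-(N+1)/C}) around U(t): the inverse equation of state ρ_t ↦
a_t at reduced diameter σ plus the exponential LLN of LocalGibbsConcentration (0767) at the new
activity. Static at low density (cluster expansion: Ruelle1969 Ch.4, LebowitzPenrose1964); the
dynamical content is that σ₀ is fixed from the INITIAL profiles while ρ_t may grow by compression —
the hypothesis 'fields converge at t' bounds ρ_tσ³ only by close packing, not by the cluster radius.
Implied by DiluteSelfConsistency (stmt-AtomisticToContinuum-3091, route ImplosionLoophole) + the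
static inversion; refuted together with it by DenseExcursion (3090). Supplies the references
consumed by ShortTimePropagation/RestartEntropy at every restart; implicit in RelEntropyVanishing
(0766). -/
@[route_item "route-AtomisticToContinuum-FirstFailureBlowup"]
def ProfileRealisability : Prop :=
  open Literature.MathematicalPhysics.KineticTheory Literature.Analysis.FluidPDE in ∀ (a₀ θ₀ : T3 → ℝ) (u₀ : T3 → V3), Continuous a₀ → Continuous θ₀ → Continuous u₀ → (∀ x, 0 < a₀ x) → (∀ x, 0 < θ₀ x) → ∃ σ₀ : ℝ, 0 < σ₀ ∧ ∀ σ : ℝ, 0 < σ → σ < σ₀ → ∀ (T : ℝ) (ρ θ : ℝ → T3 → ℝ) (u : ℝ → T3 → V3), IsHardSphereEulerSolution σ T ρ u θ → ∀ Φ : (N : ℕ) → HardSphereFlow (Torus.geometry (Fin 3)) (hsDiameter σ N) (N + 1), let P := fun N => localGibbsLaw σ a₀ u₀ θ₀ N (Φ N); (∀ N, IsProbabilityMeasure (P N)) → TendstoHydroFieldsAt P Φ ρ u θ 0 → ∀ t ∈ Ico 0 T, TendstoHydroFieldsAt P Φ ρ u θ t → ∃ a : T3 → ℝ, Continuous a ∧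 (∀ x, 0 < a x) ∧ (∀ N, IsProbabilityMeasure (localGibbsLaw σ a (u t) (θ t) N (Φ N))) ∧ (∀ χ : T3 → ℝ, Continuous χ → ∀ δ : ℝ, 0 < δ → ∃ C : ℝ, 0 < C ∧ ∀ N : ℕ, localGibbsLaw σ a (u t) (θ t) N (Φ N) {z | δ < |empiricalDensityField z χ - ∫ x, χ x * ρ t x|} ≤ ENNReal.ofReal (C * Real.exp (-(C⁻¹ * (N + 1)))) ∧ localGibbsLaw σ a (u t) (θ t) N (Φ N) {z | δ < ‖empiricalMomentumField z χ - ∫ x, (χ x * ρ t x) • u t x‖} ≤ ENNReal.ofReal (C * Real.exp (-(C⁻¹ * (N + 1)))) ∧ localGibbsLaw σ a (u t) (θ t) N (Φ N) {z | δ < |empiricalEnergyField z χ - ∫ x, χ x * totalEnergyDensity (ρ t x) (u t x) (θ t x)|} ≤ ENNReal.ofReal (C * Real.exp (-(C⁻¹ * (N + 1)))))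

/-- item stmt-AtomisticToContinuum-0767 · support · rank 9 · closed · moot by None · by planner
sources: Ruelle1969, LebowitzPenrose1964
[support] Exponential law of large numbers for canonical local Gibbs states of N+1 hard spheres of
diameter σ(N+1)^{-1/3} on 𝕋³: for continuous a, θ₀ > 0, u₀, ∃ σ₀ ∀ σ<σ₀ ∃ continuous ρ₀ > 0
(equilibrium density profile at activity a) with the laws probability measures for all N and
P(|field − limit| > δ) ≤ C e^{-(N+1)/C} for the three fields, C = C(χ, δ) uniform in N and in the
flow. Low-density cluster expansion (Ruelle1969 Ch. 4, LebowitzPenrose1964) + Gaussian velocities.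
Strengthens Literature fact localGibbs_lln. -/
@[route_item "route-AtomisticToContinuum-FirstFailureBlowup"]
def LocalGibbsConcentration : Prop :=
  ∀ (a θ₀ : Literature.MathematicalPhysics.KineticTheory.T3 → ℝ) (u₀ : Literature.MathematicalPhysics.KineticTheory.T3 → Literature.MathematicalPhysics.KineticTheory.V3), Continuous a → Continuous θ₀ → Continuous u₀ → (∀ x, 0 < a x) → (∀ x, 0 < θ₀ x) → ∃ σ₀ : ℝ, 0 < σ₀ ∧ ∀ σ : ℝ, 0 < σ → σ < σ₀ → ∃ ρ₀ : Literature.MathematicalPhysics.KineticTheory.T3 → ℝ, Continuous ρ₀ ∧ (∀ x, 0 < ρ₀ x) ∧ (∀ (N : ℕ) (Φ : Literature.Analysis.FluidPDE.HardSphereFlow (Literature.Analysis.FluidPDE.Torus.geometry (Fin 3)) (Literature.MathematicalPhysics.KineticTheory.hsDiameter σ N) (N + 1)), MeasureTheory.IsProbabilityMeasure (Literature.MathematicalPhysics.KineticTheory.localGibbsLaw σ a u₀ θ₀ N Φ)) ∧ ∀ χ : Literature.MathematicalPhysics.KineticTheory.T3 → ℝ, Continuous χ → ∀ δ : ℝ,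 0 < δ → ∃ C : ℝ, 0 < C ∧ ∀ (N : ℕ) (Φ : Literature.Analysis.FluidPDE.HardSphereFlow (Literature.Analysis.FluidPDE.Torus.geometry (Fin 3)) (Literature.MathematicalPhysics.KineticTheory.hsDiameter σ N) (N + 1)), Literature.MathematicalPhysics.KineticTheory.localGibbsLaw σ a u₀ θ₀ N Φ {z | δ < |Literature.MathematicalPhysics.KineticTheory.empiricalDensityField z χ - ∫ x, χ x * ρ₀ x|} ≤ ENNReal.ofReal (C * Real.exp (-(C⁻¹ * (N + 1)))) ∧ Literature.MathematicalPhysics.KineticTheory.localGibbsLaw σ a u₀ θ₀ N Φ {z | δ < ‖Literature.MathematicalPhysics.KineticTheory.empiricalMomentumField z χ - ∫ x, (χ x * ρ₀ x) • u₀ x‖} ≤ ENNReal.ofReal (C * Real.exp (-(C⁻¹ * (N + 1)))) ∧ Literature.MathematicalPhysics.KineticTheory.localGibbsLaw σ a u₀ θ₀ N Φ {z | δ < |Literature.MathematicalPhysics.KineticTheory.empiricalEnergyField z χ - ∫ x, χ x * Literature.MathematicalPhysics.KineticTheory.totalEnergyDensity (ρ₀ x) (u₀ x) (θ₀ x)|}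 ≤ ENNReal.ofReal (C * Real.exp (-(C⁻¹ * (N + 1))))

/-- item stmt-AtomisticToContinuum-3332 · support · rank 9 · closed · moot by None · by planner
sources: Spohn1991, BGSSCPAM2023, Sideris1985
[support] SMALL-DATA HYDRODYNAMICS WITH UNIFORM CONSTANTS (the card's 'small-data theorem with
Knudsen gain', unit-torus form; intended child of ShortTimePropagation). ∃ σ₀ ∀ σ<σ₀ ∀ rest state
(density 1, ū, θ̄) ∃ δ₀, τ₀ > 0: for local Gibbs data whose Euler data U(0) are δ₀-close to the rest
state in C²(𝕋³) (values, first and second Torus.partialDeriv), the fields follow the classical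
solution in probability for t < min(T, τ₀). The Knudsen gain is automatic (N → ∞ at fixed σ); what
is asked beyond the conjunct is uniformity of σ₀, δ₀, τ₀ over the small-data class — exactly what
the zoom consumes (data zoomed at radius r have j-th derivatives O(r^j)). Tools available only here:
amplitude expansion around the flow-invariant Gibbs law (equilibrium space-time cumulants; cards
amplitude-analyticity-transfer, transient-covariance-identity), Koopman spectral theory of (g, Φ_t),
near-equilibrium hard-sphere technology (BGSSCPAM2023, dilute scaling). Falsifier: MD relaxation of
a small shear/entropy wave at packing 0.05–0.1 — damping per sound period must scale like Kn.
Refuting it refutes the conjunct in substance. Sources: Spohn1991 §7.1; BGSSCPAM2023; Sideris1985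
(small data shock only -/
@[route_item "route-AtomisticToContinuum-FirstFailureBlowup"]
def SmallDataHydrodynamics : Prop :=
  open Literature.MathematicalPhysics.KineticTheory Literature.Analysis.FluidPDE Literature.Analysis.FunctionSpaces in ∃ σ₀ : ℝ, 0 < σ₀ ∧ ∀ σ : ℝ, 0 < σ → σ < σ₀ → ∀ θbar : ℝ, 0 < θbar → ∀ ubar : V3, ∃ δ₀ : ℝ, 0 < δ₀ ∧ ∃ τ₀ : ℝ, 0 < τ₀ ∧ ∀ (a₀ θ₀ : T3 → ℝ) (u₀ : T3 → V3), Continuous a₀ → Continuous θ₀ → Continuous u₀ → (∀ x, 0 < a₀ x) → (∀ x, 0 < θ₀ x) → ∀ (T : ℝ) (ρ θ : ℝ → T3 → ℝ) (u : ℝ → T3 → V3), IsHardSphereEulerSolution σ T ρ u θ → (∀ x, |ρ 0 x - 1| ≤ δ₀ ∧ ‖u 0 x - ubar‖ ≤ δ₀ ∧ |θ 0 x - θbar| ≤ δ₀) → (∀ (i : Fin 3) x, |Torus.partialDeriv i (ρ 0) x| ≤ δ₀ ∧ ‖Torus.partialDeriv i (u 0) x‖ ≤ δ₀ ∧ |Torus.partialDeriv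 i (θ 0) x| ≤ δ₀) → (∀ (i j : Fin 3) x, |Torus.partialDeriv i (Torus.partialDeriv j (ρ 0)) x| ≤ δ₀ ∧ ‖Torus.partialDeriv i (Torus.partialDeriv j (u 0)) x‖ ≤ δ₀ ∧ |Torus.partialDeriv i (Torus.partialDeriv j (θ 0)) x| ≤ δ₀) → ∀ Φ : (N : ℕ) → HardSphereFlow (Torus.geometry (Fin 3)) (hsDiameter σ N) (N + 1), let P := fun N => localGibbsLaw σ a₀ u₀ θ₀ N (Φ N); (∀ N, IsProbabilityMeasure (P N)) → TendstoHydroFieldsAt P Φ ρ u θ 0 → ∀ t ∈ Ico 0 (min T τ₀), TendstoHydroFieldsAt P Φ ρ u θ t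

/-- item stmt-AtomisticToContinuum-3333 · support · rank 9 · closed · moot by None · by planner
sources: Ruelle1969, LebowitzPenrose1964, Spohn1991
[support] CANONICAL INHOMOGENEOUS THERMODYNAMIC LIMIT: for continuous a, θ₀ > 0, u₀ and σ < σ₀ the
specific log-partition function (N+1)⁻¹ log canonicalPartition(Torus.geometry, hsDiameter σ N, N+1,
localGibbsProfile a u₀ θ₀) converges. The velocity integrals equal 1, so the limit Π_σ[a] depends on
a only; expected value Π_σ[a] = sup_{∫ρ=1} {∫ρ log a − ∫ρ log ρ − ∫ρ F(ρσ³)} with F from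
HsEosLowDensity (0768) (local density approximation, exact since ε_N → 0 macroscopically) — the
sharper identification rides as a --supports lemma. First input of RestartEntropy; also needed by
RelEntropyGronwall (0780). Ruelle1969 §3.4; LebowitzPenrose1964; Spohn1991 I.3. -/
@[route_item "route-AtomisticToContinuum-FirstFailureBlowup"]
def PressureFunctional : Prop :=
  open Literature.MathematicalPhysics.KineticTheory Literature.Analysis.FluidPDE in ∀ (a θ₀ : T3 → ℝ) (u₀ : T3 → V3), Continuous a → Continuous θ₀ → Continuous u₀ → (∀ x, 0 < a x) → (∀ x, 0 < θ₀ x) → ∃ σ₀ : ℝ, 0 < σ₀ ∧ ∀ σ : ℝ, 0 < σ → σ < σ₀ → ∃ p : ℝ, Tendsto (fun N : ℕ => ((N : ℝ) + 1)⁻¹ * Real.log (canonicalPartition (Torus.geometry (Fin 3)) (hsDiameter σ N) (N + 1) (localGibbsProfile a u₀ θ₀))) atTop (𝓝 p)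

/-- item stmt-AtomisticToContinuum-3334 · support · rank 9 · closed · moot by None · by planner
sources: GST2013, Spohn1991
[support] EXPONENTIAL MOMENT OF THE KINETIC ENERGY, UNIFORM IN TIME: ∃ l > 0, C with ∫
exp(l·configEnergy) d((Φ_t)_* localGibbsLaw σ a₀ u₀ θ₀) ≤ e^{C(N+1)} for all σ, N, Φ, t — Gaussian
velocities at time 0 (take l < 1/(2 sup θ₀)) and exact conservation of configEnergy along
hard-sphere trajectories on the good set (IsHardSphereTrajectory.configEnergy_eq; lawAt = map (flow
t)); vacuous-safe (zero law when the partition function vanishes). Gives uniform integrability of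
the momentum/energy fields (|field| ≤ ‖χ‖∞·configEnergy/(N+1)) needed in RestartEntropy to pass from
convergence in probability to convergence of expectations. GST2013 §4.2; Spohn1991 I.3. -/
@[route_item "route-AtomisticToContinuum-FirstFailureBlowup"]
def KineticEnergyExpMoment : Prop :=
  open Literature.MathematicalPhysics.KineticTheory Literature.Analysis.FluidPDE in ∀ (a₀ θ₀ : T3 → ℝ) (u₀ : T3 → V3), Continuous a₀ → Continuous θ₀ → Continuous u₀ → (∀ x, 0 < a₀ x) → (∀ x, 0 < θ₀ x) → ∃ l : ℝ, 0 < l ∧ ∃ C : ℝ, ∀ (σ : ℝ) (N : ℕ) (Φ : HardSphereFlow (Torus.geometry (Fin 3)) (hsDiameter σ N) (N + 1)) (t : ℝ), ∫⁻ z, ENNReal.ofReal (Real.exp (l * configEnergy z)) ∂(Φ.lawAt (localGibbsLaw σ a₀ u₀ θ₀ N Φ) t) ≤ ENNReal.ofReal (Real.exp (C * (N + 1)))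

/-- item stmt-AtomisticToContinuum-3335 · assembly · rank 1 · closed · moot by None · by planner
sources: Spohn1991, Yau1991
[assembly] ShortTimePropagation → RestartEntropy → ProfileRealisability → LocalGibbsConcentration →
HydrodynamicLimit. Soft: σ₀ := min of the four σ₀ for the given profiles; base s = 0: flow 0 = id
Liouville-a.e. and P ≪ Liouville, so lawAt P 0 = P and klDiv P P = 0; TendstoHydroFieldsAt at 0 +
LocalGibbsConcentration + uniqueness of limits in probability (P_N probability measures) +
continuity give (ρ 0, u 0, θ 0) = (ρ^{a₀}, u₀, θ₀), so the datum is its own exponentially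
concentrating reference with activity a₀. Step: s_k := min T' (kτ) with τ from ShortTimePropagation
at T'; ShortTimePropagation at s_k gives TendstoHydroFieldsAt on [s_k, s_{k+1}];
ProfileRealisability then RestartEntropy at s_{k+1} give the entropy hypothesis there; ⌈T'/τ⌉ steps
cover [0,T']; finally T' := t for each t ∈ Ico 0 T. This is the contrapositive of the card's
first-failure-time extraction. -/
@[route_item "route-AtomisticToContinuum-FirstFailureBlowup"]
def Assembly : Prop :=
  ShortTimePropagation → RestartEntropy → ProfileRealisability → LocalGibbsConcentration → Literature.MathematicalPhysics.KineticTheory.HydrodynamicLimit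

end Summit.AtomisticToContinuum.HydrodynamicLimit.Theses.FirstFailureBlowup
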